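import Summits.QuantumFields.YangMills.Theorems.FluctuationComparisonRegPrIntLS1aHistoryLettersOfRestrictedDensities
import HarnessLib

/-!
# S1a · THE ATOMIC FORM OF THE HISTORY LETTERS: ONE LARGE PLAQUETTE PER LARGE HEIGHT — print's «small factor per large-field plaquette» ((71) p.273) with the site
# entropy `|Plaq^{(i+1)}|` explicit; the per-history density letters of ✓`…S1aHistoryLettersOfRestrictedDensities` from ATOMIC letters by a union bound over the
# choices of one large plaquette at each large height

Cell `ym3-torus` (YM ladder rung R3 = continuum `SU(2)` Yang–Mills on the three-torus — a RUNG: NOT d = 4, NOT infinite volume, NOT a mass gap, NOT Clay).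
Width seat «width 8» `ym3-torus-px8` (gen 27), FREE px helper on crux `stmt-QuantumFields-20520`, count-neutral, DEFINITION-FREE, default heartbeats.  FILE 3 of the seat
(FILE 1 ✓`…S1aDomBGOfHistoryLetters`: the history expansion, `hdomBG_j` ⟸ per-history letters at measure level; FILE 2 ✓`…S1aHistoryLettersOfRestrictedDensities`: the letters
in the currency of print's restricted renormalised densities `ρ^{E}_{K−j}`).

WHY.  After FILE 2 the residual of the (m)_E cut heights reads, per nonempty history `S ⊆ [j, Ts)`: «`ρ^{E_S}_{K−j}(V) ≤ (Π_{i∈S} ω_i)·ρ^{E₁}_{K−j}(V)` a.e. on the good data»,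
with `E_S` = «off the plateau at the cut steps of `S`, inside the support window elsewhere».  Print's small factor is PER LARGE PLAQUETTE ([Balaban1985UV3] (7) p.257: `χ_k = Π_p χ(p)`
expanded into large-field SETS `P_k`; (71) p.273: «We get these small factors for all plaquettes in all large fields set P»), and «off the plateau» at a height means «SOME plaquette
of that height is large».  For an UPPER bound a union bound over the choice of ONE large plaquette per large height suffices (no plaquette SETS needed): `E_S ⊆ ⋃_π E_{S,π}`, `π`
ranging over the `Π_{i∈S} |Plaq^{(i+1)}|` choice functions, `E_{S,π}` = «plaquette `π_i` of `Ū_{i+1}` is large at every `i ∈ S`, support window elsewhere».  So the per-history letter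
follows from ATOMIC letters «`ρ^{E_{S,π}}_{K−j} ≤ (Π_{i∈S} ε_i)·ρ^{E₁}_{K−j}`» with `ω_i = |Plaq^{(i+1)}|·ε_i` — print's `ε ~ e^{−¼p²(g)}` per large plaquette against the site entropy
`|Plaq^{(i+1)}| = 3|T^{(i+1)}|`, the exponent budget of UV3-NODE §69.19-A (3) ∕ §69.20 (4)(d) now a kernel identity (`Fintype.card_pi`).

WHAT (0 `def`, 0 `sorry`).
§0 `restrictedMass_le_card_mul_of_atoms` — union bound over a finite family of atoms at measure level [folklore].
§1 ★★`restrictedMass_le_of_heightDensityLetter` ∕ ★★`heightDensityLetter_of_restrictedMass` — AT THE T³ RUNS, BOTH DIRECTIONS between «`ρ^{E} ≤ c·ρ^{E'}` a.e. on `D`» and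
   «`Gibbs_K(descendTo_j⁻¹A ∩ E) ≤ c·Gibbs_K(descendTo_j⁻¹A ∩ E')` for every measurable `A ⊆ D`» (lit ✓`T3TiltDescent.map_descendTo_restrict_eq_withDensity`; `Z_K⁻¹` cancels;
   the converse by uniqueness of densities through ✓p832521's `withDensity_restrict_le_of_forall_le` ∕ `ae_restrict_le_of_withDensity_restrict_le`).
§2 `measurableSet_atomEvent` ∕ ★`histEvent_subset_iUnion_atomEvent` — the atomic events of run `K` (choice functions `π : (i : ↥S) → Plaq (F.P (i+1)) 0`) are measurable and
   COVER the history's large∕support event (`hcover : U ∉ Tg i → ∃ p, U ∈ Lg i p`; for `sfCut θ`: `Lg i p = {θ∕2 < dist1 (U(∂p))}`).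
§3 ★★★`heightDensityLetter_of_atomicLetters` — atomic letters for every `π` ⟹ FILE 2's history letter for `S` with `ω_i := |Plaq^{(i+1)}|·ε_i`.
§4 ★★★`hdomBG_of_atomicLetters` — the composition with FILE 2's `hdomBG_of_heightDensityLetters`: atomic letters for every nonempty `S ⊆ [j, Ts)` and every `π`, with
   `Σ_{i∈[j,Ts)} |Plaq^{(i+1)}|·ε_i ≤ Δ` ⟹ the `hdomBG_j` binder of ✓p831345 VERBATIM.

★p1's RESIDUAL FOR THE (m)_E CUT HEIGHTS, ATOMIC PRINT-SHAPED FORM (UV3-NODE §69.20; nothing asserted): per height `j`, per nonempty set `S ⊆ [j, Ts)` of cut steps and per choice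
`π` of one plaquette `π_i ∈ Plaq^{(i+1)}` for `i ∈ S`: «`ρ^{E_{S,π}}_{K−j}(V) ≤ (Π_{i∈S} ε_i)·ρ^{E₁}_{K−j}(V)` at (almost) every (E)-good `V`», `Σ_{i≥j} 3|T^{(i+1)}|·ε_i ≤ Δ_j` — [Balaban1985UV3]
(41)'s term of the history «plaquette `π_i` of the `(i+1)`-th average large, `i ∈ S`; small field at the other cut heights» against the all-small term, with print's inputs per
atom: (a) the small factor (67)–(71) at each `(i, π_i)` (kernel on the torus for print's average: lit ✓`B10Eq71TorusLocal`; for `ℰp` only the sup-(53) input ✓`BlockAveragingEMLProp2`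
is in the tree), (b) variational monotonicity (42), (c) the RELATIVE volume cost `e^{O(log g⁻¹)|Z|}` per atom = locality of the effective-action difference (NOT a printed sentence),
(d) resummation and entropy — kernel (FILE 1 §0 + this file).  HONEST: measure-theoretic bookkeeping over landed kernel facts; every `ε_i` and every atomic letter is a HYPOTHESIS;
`hdomBG_j` REDUCED, NOT discharged; nothing of Bałaban's renormalisation-group analysis asserted or proved; (α) package UNINHABITED; (m) AS TYPED suspect-false@L=3 (RULING №105),
(m)_E OPEN; the five registered stubs (3732b7df UNTOUCHED, 0∕5) ∕ 20520 ∕ 19936 ∕ 19200 ∕ `YM3TorusSU2` NOT proved; rung R3 = SU(2) YM₃ on T³ at fixed lattice data — NOT d = 4,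
NOT infinite volume, NOT a mass gap, NOT Clay.  Sorry-free, axioms standard.
References: [Balaban1985UV3] CMP 102 (1985) (2) p.256, (7) p.257, (8) p.258, (38)–(42) p.266, (47) p.267, (67)–(71) pp.273–274; [Balaban1987RG1] CMP 109 (1987) (0.11) p.253.
-/

set_option autoImplicit false

noncomputable section

namespace Summit.QuantumFields.YangMills.Theorems.FluctuationComparisonRegPrIntLS1aHistoryLettersAtomic

open MeasureTheory Filter Topology Set Function
open scoped ENNReal NNReal
open Literature.MathematicalPhysics.QuantumFieldTheory.Balaban1983to89
open T3ContinuumYM3Torus T3NestedUnitLaws T3UnitLawDensityEML T3UnitScaleTilt T3LevelShift T3TiltDescent T4Continuum BalabanUVClass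
open Literature.MathematicalPhysics.QuantumFieldTheory.Balaban1983to89.Missing
open scoped Literature.MathematicalPhysics.QuantumFieldTheory.Balaban1983to89.T3OrbitAverage
open Summit.QuantumFields.YangMills.Theorems.FluctuationComparisonRegPrIntLS1aDomBGOfOneStepLetters
  (withDensity_restrict_le_of_forall_le ae_restrict_le_of_withDensity_restrict_le)
open Summit.QuantumFields.YangMills.Theorems.FluctuationComparisonRegPrIntLS1aHistoryLettersOfRestrictedDensities
  (measurableSet_histEvent measurableSet_plateauEvent hdomBG_of_heightDensityLetters)

/-! ## §0 Measure currency: a union bound over finitely many atoms -/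

section Abstract

variable {X : Type*} [MeasurableSpace X]

/-- **UNION BOUND OVER ATOMS.**  If `E ⊆ ⋃_{π} E_π` over a finite index type and every atom satisfies `G (B ∩ E_π) ≤ c · G (B ∩ E₁)`, then
`G (B ∩ E) ≤ (|κ| · c) · G (B ∩ E₁)`. [folklore] -/
theorem restrictedMass_le_card_mul_of_atoms (G : Measure X) {κ : Type*} [Fintype κ] {B E E₁ : Set X} {Ea : κ → Set X}
    (hcover : E ⊆ ⋃ π, Ea π) {c : ℝ≥0∞} (h : ∀ π, G (B ∩ Ea π) ≤ c * G (B ∩ E₁)) :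
    G (B ∩ E) ≤ (Fintype.card κ : ℝ≥0∞) * c * G (B ∩ E₁) := by
  calc G (B ∩ E) ≤ G (⋃ π, B ∩ Ea π) := by
        refine measure_mono fun x hx => ?_
        obtain ⟨π, hπ⟩ := mem_iUnion.mp (hcover hx.2)
        exact mem_iUnion.mpr ⟨π, hx.1, hπ⟩
    _ ≤ ∑ π, G (B ∩ Ea π) := measure_iUnion_fintype_le G _
    _ ≤ ∑ _π : κ, c * G (B ∩ E₁) := Finset.sum_le_sum fun π _ => h π
    _ = (Fintype.card κ : ℝ≥0∞) * c * G (B ∩ E₁) := by rw [Finset.sum_const, Finset.card_univ, nsmul_eq_mul, mul_assoc]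

end Abstract

/-! ## §1 At the T³ runs: restricted Gibbs masses ⟺ restricted renormalised densities (both directions) -/

section Currency

variable (F : T3Family) {γ : ℝ} (hγ : 0 ≤ γ) {K j : ℕ} (hjK : j ≤ K)

include hγ in
/-- **DENSITY LETTER ⟹ MASS LETTER**: for measurable events `E, E'` of run `K`, «`ρ^{E}_{K−j} ≤ c · ρ^{E'}_{K−j}` `dU_j`-a.e. on `D`» (`c ≥ 0`) gives, for every measurable `A ⊆ D`,
`Gibbs_K (descendTo_j⁻¹A ∩ E) ≤ c · Gibbs_K (descendTo_j⁻¹A ∩ E')` (lit ✓`map_descendTo_restrict_eq_withDensity`; `Z_K⁻¹` cancels). [cite: Balaban1985UV3, (2) p.256 and (41) p.266] -/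
theorem restrictedMass_le_of_heightDensityLetter {E E' : Set (GaugeField (F.P K) 0 ↥(Matrix.specialUnitaryGroup (Fin 2) ℂ))}
    (hE : MeasurableSet E) (hE' : MeasurableSet E') {c : ℝ} (hc : 0 ≤ c) {D : Set (GaugeField (F.P j) 0 ↥(Matrix.specialUnitaryGroup (Fin 2) ℂ))}
    (hdens : ∀ᵐ V ∂(fieldMeasure (F.P j) 0 ↥(Matrix.specialUnitaryGroup (Fin 2) ℂ)), V ∈ D →
      heightDensity F γ hjK E V ≤ c * heightDensity F γ hjK E' V)
    {A : Set (GaugeField (F.P j) 0 ↥(Matrix.specialUnitaryGroup (Fin 2) ℂ))} (hA : MeasurableSet A) (hAD : A ⊆ D) :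
    gibbsK F ℰp γ K (descendTo F ℰp j K hjK ⁻¹' A ∩ E) ≤ ENNReal.ofReal c * gibbsK F ℰp γ K (descendTo F ℰp j K hjK ⁻¹' A ∩ E') := by
  have hD : Measurable (descendTo F ℰp j K hjK : GaugeField (F.P K) 0 ↥(Matrix.specialUnitaryGroup (Fin 2) ℂ) →
      GaugeField (F.P j) 0 ↥(Matrix.specialUnitaryGroup (Fin 2) ℂ)) := measurable_descendTo F ℰp measurableE_ℰp hjK
  have hZ : 0 < partitionFn (G := ↥(Matrix.specialUnitaryGroup (Fin 2) ℂ)) (F.P K) ((F.scheme ℰp γ).β K) :=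
    partitionFn_pos' _ (F.scheme_β_nonneg ℰp hγ K)
  have key : ∀ (E : Set (GaugeField (F.P K) 0 ↥(Matrix.specialUnitaryGroup (Fin 2) ℂ))), MeasurableSet E →
      gibbsK F ℰp γ K (descendTo F ℰp j K hjK ⁻¹' A ∩ E) =
        ∫⁻ V in A, ENNReal.ofReal ((partitionFn (G := ↥(Matrix.specialUnitaryGroup (Fin 2) ℂ)) (F.P K) ((F.scheme ℰp γ).β K))⁻¹ *
          heightDensity F γ hjK E V) ∂(fieldMeasure (F.P j) 0 ↥(Matrix.specialUnitaryGroup (Fin 2) ℂ)) := by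
    intro E hE
    rw [← Measure.restrict_apply' hE, ← Measure.map_apply hD hA, map_descendTo_restrict_eq_withDensity F hjK hE hγ, withDensity_apply _ hA]
  rw [key E hE, key E' hE', ← lintegral_const_mul' _ _ ENNReal.ofReal_ne_top]
  refine setLIntegral_mono_ae' hA ?_
  filter_upwards [hdens] with V hV hVA
  rw [← ENNReal.ofReal_mul hc]
  refine ENNReal.ofReal_le_ofReal ?_
  have h := hV (hAD hVA)
  calc (partitionFn (G := ↥(Matrix.specialUnitaryGroup (Fin 2) ℂ)) (F.P K) ((F.scheme ℰp γ).β K))⁻¹ * heightDensity F γ hjK E V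
      ≤ (partitionFn (G := ↥(Matrix.specialUnitaryGroup (Fin 2) ℂ)) (F.P K) ((F.scheme ℰp γ).β K))⁻¹ * (c * heightDensity F γ hjK E' V) :=
        mul_le_mul_of_nonneg_left h (inv_nonneg.mpr hZ.le)
    _ = c * ((partitionFn (G := ↥(Matrix.specialUnitaryGroup (Fin 2) ℂ)) (F.P K) ((F.scheme ℰp γ).β K))⁻¹ * heightDensity F γ hjK E' V) := by ring

include hγ in
/-- **MASS LETTER ⟹ DENSITY LETTER** (the converse, by uniqueness of densities): for measurable events `E, E'` of run `K`, a measurable `D` and `c ≥ 0`, the mass letter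
«`Gibbs_K (descendTo_j⁻¹A ∩ E) ≤ c · Gibbs_K (descendTo_j⁻¹A ∩ E')` for every measurable `A ⊆ D`» gives back «`ρ^{E}_{K−j} ≤ c · ρ^{E'}_{K−j}` `dU_j`-a.e. on `D`»
(✓p832521 §2's two one-liners on the `withDensity` laws of lit ✓`map_descendTo_restrict_eq_withDensity`). [cite: Balaban1985UV3, (2) p.256 and (41) p.266] -/
theorem heightDensityLetter_of_restrictedMass {E E' : Set (GaugeField (F.P K) 0 ↥(Matrix.specialUnitaryGroup (Fin 2) ℂ))}
    (hE : MeasurableSet E) (hE' : MeasurableSet E') {c : ℝ} (hc : 0 ≤ c) {D : Set (GaugeField (F.P j) 0 ↥(Matrix.specialUnitaryGroup (Fin 2) ℂ))}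
    (hDm : MeasurableSet D)
    (hmass : ∀ A : Set (GaugeField (F.P j) 0 ↥(Matrix.specialUnitaryGroup (Fin 2) ℂ)), MeasurableSet A → A ⊆ D →
      gibbsK F ℰp γ K (descendTo F ℰp j K hjK ⁻¹' A ∩ E) ≤ ENNReal.ofReal c * gibbsK F ℰp γ K (descendTo F ℰp j K hjK ⁻¹' A ∩ E')) :
    ∀ᵐ V ∂(fieldMeasure (F.P j) 0 ↥(Matrix.specialUnitaryGroup (Fin 2) ℂ)), V ∈ D → heightDensity F γ hjK E V ≤ c * heightDensity F γ hjK E' V := by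
  have hD : Measurable (descendTo F ℰp j K hjK : GaugeField (F.P K) 0 ↥(Matrix.specialUnitaryGroup (Fin 2) ℂ) →
      GaugeField (F.P j) 0 ↥(Matrix.specialUnitaryGroup (Fin 2) ℂ)) := measurable_descendTo F ℰp measurableE_ℰp hjK
  have hZ : 0 < partitionFn (G := ↥(Matrix.specialUnitaryGroup (Fin 2) ℂ)) (F.P K) ((F.scheme ℰp γ).β K) :=
    partitionFn_pos' _ (F.scheme_β_nonneg ℰp hγ K)
  set Z := partitionFn (G := ↥(Matrix.specialUnitaryGroup (Fin 2) ℂ)) (F.P K) ((F.scheme ℰp γ).β K) with hZdef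
  obtain ⟨hmE, -⟩ := heightDensity_props F hjK hE hγ
  -- the two descended restricted Gibbs laws and their densities
  have hνt : Measure.map (descendTo F ℰp j K hjK) ((gibbsK F ℰp γ K).restrict E) =
      (fieldMeasure (F.P j) 0 ↥(Matrix.specialUnitaryGroup (Fin 2) ℂ)).withDensity fun V => ENNReal.ofReal (Z⁻¹ * heightDensity F γ hjK E V) :=
    map_descendTo_restrict_eq_withDensity F hjK hE hγ
  have hμc : Measure.map (descendTo F ℰp j K hjK) ((gibbsK F ℰp γ K).restrict E') =
      (fieldMeasure (F.P j) 0 ↥(Matrix.specialUnitaryGroup (Fin 2) ℂ)).withDensity fun V => ENNReal.ofReal (Z⁻¹ * heightDensity F γ hjK E' V) :=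
    map_descendTo_restrict_eq_withDensity F hjK hE' hγ
  have hle : ∀ A : Set (GaugeField (F.P j) 0 ↥(Matrix.specialUnitaryGroup (Fin 2) ℂ)), MeasurableSet A → A ⊆ D →
      Measure.map (descendTo F ℰp j K hjK) ((gibbsK F ℰp γ K).restrict E) A ≤
        ENNReal.ofReal c * Measure.map (descendTo F ℰp j K hjK) ((gibbsK F ℰp γ K).restrict E') A := by
    intro A hA hAD
    rw [Measure.map_apply hD hA, Measure.map_apply hD hA, Measure.restrict_apply' hE, Measure.restrict_apply' hE']
    exact hmass A hA hAD
  have hae := ae_restrict_le_of_withDensity_restrict_le (hmE.const_mul _) (fun V => mul_nonneg (inv_nonneg.mpr hZ.le) (heightDensity_nonneg F γ hjK E' V)) hc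
    (withDensity_restrict_le_of_forall_le hνt hμc hDm hle)
  rw [ae_restrict_iff' hDm] at hae
  filter_upwards [hae] with V hV hVD
  have h := hV hVD
  have h' : Z⁻¹ * heightDensity F γ hjK E V ≤ Z⁻¹ * (c * heightDensity F γ hjK E' V) := by linarith
  exact le_of_mul_le_mul_left h' (inv_pos.mpr hZ)

end Currency

/-! ## §2 The atomic events of run `K`: ONE large plaquette per large height -/

section Atoms

variable (F : T3Family) {γ : ℝ} (hγ : 0 ≤ γ) {K Ts j : ℕ} (hTs : Ts ≤ K) (hjK : j ≤ K)
  -- plateau targets, support windows, and per-plaquette LARGE events covering the complement of the plateau (for `sfCut θ`: `Lg i p = {θ∕2 < dist1 (U(∂p))}`)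
  (Tg Sp : (i : ℕ) → Set (GaugeField (F.P i) 0 ↥(Matrix.specialUnitaryGroup (Fin 2) ℂ)))
  (Lg : (i : ℕ) → Plaq (F.P i) 0 → Set (GaugeField (F.P i) 0 ↥(Matrix.specialUnitaryGroup (Fin 2) ℂ)))
  (hTgm : ∀ i, MeasurableSet (Tg i)) (hSpm : ∀ i, MeasurableSet (Sp i)) (hLgm : ∀ i p, MeasurableSet (Lg i p))
  (hcover : ∀ i U, U ∉ Tg i → ∃ p, U ∈ Lg i p)

include hSpm hLgm in
/-- The ATOMIC event of the history `S` with the choice `π` of one large plaquette per large height — «plaquette `π_i` of `Ū_{i+1}` is large at every cut step `i ∈ S`, the field is inside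
the support window at every other cut step of `[j, Ts)`» — is measurable. [cite: Balaban1985UV3, (7) p.257 and (40) p.266] -/
theorem measurableSet_atomEvent (S : Finset ℕ) (π : (i : ↥S) → Plaq (F.P ((i : ℕ) + 1)) 0) :
    MeasurableSet {U : GaugeField (F.P K) 0 ↥(Matrix.specialUnitaryGroup (Fin 2) ℂ) |
      (∀ i : ↥S, ∀ (h : (i : ℕ) + 1 ≤ K), descendTo F ℰp ((i : ℕ) + 1) K h U ∈ Lg ((i : ℕ) + 1) (π i)) ∧
      (∀ i ∈ Finset.Ico j Ts, i ∉ S → ∀ (h : i + 1 ≤ K), descendTo F ℰp (i + 1) K h U ∈ Sp (i + 1))} := by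
  have hpre : ∀ (i : ℕ) (T : Set (GaugeField (F.P (i + 1)) 0 ↥(Matrix.specialUnitaryGroup (Fin 2) ℂ))), MeasurableSet T →
      MeasurableSet {U : GaugeField (F.P K) 0 ↥(Matrix.specialUnitaryGroup (Fin 2) ℂ) | ∀ (h : i + 1 ≤ K), descendTo F ℰp (i + 1) K h U ∈ T} := by
    intro i T hT
    by_cases h : i + 1 ≤ K
    · have e : {U : GaugeField (F.P K) 0 ↥(Matrix.specialUnitaryGroup (Fin 2) ℂ) | ∀ (h : i + 1 ≤ K), descendTo F ℰp (i + 1) K h U ∈ T} =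
          descendTo F ℰp (i + 1) K h ⁻¹' T := by
        ext U; exact ⟨fun hU => hU h, fun hU _ => hU⟩
      rw [e]
      exact measurable_descendTo F ℰp measurableE_ℰp h hT
    · have e : {U : GaugeField (F.P K) 0 ↥(Matrix.specialUnitaryGroup (Fin 2) ℂ) | ∀ (h : i + 1 ≤ K), descendTo F ℰp (i + 1) K h U ∈ T} = univ := by
        ext U
        simp only [mem_setOf_eq, mem_univ, iff_true]
        exact fun h' => (h h').elim
      rw [e]
      exact MeasurableSet.univ
  -- the second conjunct is the plateau∕support bookkeeping of ✓`measurableSet_histEvent` (history `S`, targets := support windows read as targets is not needed: reuse with `Tg := Sp`)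
  have h2 : MeasurableSet {U : GaugeField (F.P K) 0 ↥(Matrix.specialUnitaryGroup (Fin 2) ℂ) |
      (∀ i ∈ S, ∀ (h : i + 1 ≤ K), descendTo F ℰp (i + 1) K h U ∉ (∅ : Set _)) ∧
      (∀ i ∈ Finset.Ico j Ts, i ∉ S → ∀ (h : i + 1 ≤ K), descendTo F ℰp (i + 1) K h U ∈ Sp (i + 1))} :=
    measurableSet_histEvent F (fun _ => ∅) Sp (fun _ => MeasurableSet.empty) hSpm S
  have e2 : {U : GaugeField (F.P K) 0 ↥(Matrix.specialUnitaryGroup (Fin 2) ℂ) |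
      (∀ i ∈ S, ∀ (h : i + 1 ≤ K), descendTo F ℰp (i + 1) K h U ∉ (∅ : Set _)) ∧
      (∀ i ∈ Finset.Ico j Ts, i ∉ S → ∀ (h : i + 1 ≤ K), descendTo F ℰp (i + 1) K h U ∈ Sp (i + 1))} =
      {U | ∀ i ∈ Finset.Ico j Ts, i ∉ S → ∀ (h : i + 1 ≤ K), descendTo F ℰp (i + 1) K h U ∈ Sp (i + 1)} := by
    ext U
    simp only [mem_setOf_eq, mem_empty_iff_false, not_false_eq_true, implies_true, true_and]
  rw [e2] at h2
  have h1 : MeasurableSet {U : GaugeField (F.P K) 0 ↥(Matrix.specialUnitaryGroup (Fin 2) ℂ) |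
      ∀ i : ↥S, ∀ (h : (i : ℕ) + 1 ≤ K), descendTo F ℰp ((i : ℕ) + 1) K h U ∈ Lg ((i : ℕ) + 1) (π i)} := by
    have e : {U : GaugeField (F.P K) 0 ↥(Matrix.specialUnitaryGroup (Fin 2) ℂ) |
        ∀ i : ↥S, ∀ (h : (i : ℕ) + 1 ≤ K), descendTo F ℰp ((i : ℕ) + 1) K h U ∈ Lg ((i : ℕ) + 1) (π i)} =
        ⋂ i : ↥S, {U | ∀ (h : (i : ℕ) + 1 ≤ K), descendTo F ℰp ((i : ℕ) + 1) K h U ∈ Lg ((i : ℕ) + 1) (π i)} := by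
      ext U; simp
    rw [e]
    exact MeasurableSet.iInter fun i => hpre i _ (hLgm _ _)
  exact h1.inter h2

include hcover in
/-- **THE LARGE∕SUPPORT EVENT OF A HISTORY IS COVERED BY ITS ATOMS**: off the plateau at every height of `S` means SOME plaquette is large at each of them, so `E_S ⊆ ⋃_π E_{S,π}` over
the finitely many choices `π` of one plaquette per large height. [cite: Balaban1985UV3, (7) p.257] -/
theorem histEvent_subset_iUnion_atomEvent (S : Finset ℕ) (hS : ∀ i ∈ S, i + 1 ≤ K) :
    {U : GaugeField (F.P K) 0 ↥(Matrix.specialUnitaryGroup (Fin 2) ℂ) |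
      (∀ i ∈ S, ∀ (h : i + 1 ≤ K), descendTo F ℰp (i + 1) K h U ∉ Tg (i + 1)) ∧
      (∀ i ∈ Finset.Ico j Ts, i ∉ S → ∀ (h : i + 1 ≤ K), descendTo F ℰp (i + 1) K h U ∈ Sp (i + 1))} ⊆
    ⋃ π : (i : ↥S) → Plaq (F.P ((i : ℕ) + 1)) 0, {U : GaugeField (F.P K) 0 ↥(Matrix.specialUnitaryGroup (Fin 2) ℂ) |
      (∀ i : ↥S, ∀ (h : (i : ℕ) + 1 ≤ K), descendTo F ℰp ((i : ℕ) + 1) K h U ∈ Lg ((i : ℕ) + 1) (π i)) ∧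
      (∀ i ∈ Finset.Ico j Ts, i ∉ S → ∀ (h : i + 1 ≤ K), descendTo F ℰp (i + 1) K h U ∈ Sp (i + 1))} := by
  intro U hU
  -- choose a large plaquette at every large height (all of them are cut heights: `i + 1 ≤ K`)
  have hch : ∀ i : ↥S, ∃ p : Plaq (F.P ((i : ℕ) + 1)) 0, ∀ (h : (i : ℕ) + 1 ≤ K), descendTo F ℰp ((i : ℕ) + 1) K h U ∈ Lg ((i : ℕ) + 1) p := by
    intro i
    obtain ⟨p, hp⟩ := hcover ((i : ℕ) + 1) (descendTo F ℰp ((i : ℕ) + 1) K (hS i i.2) U) (hU.1 i i.2 (hS i i.2))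
    exact ⟨p, fun _ => hp⟩
  choose π hπ using hch
  exact mem_iUnion.mpr ⟨π, fun i h => hπ i h, hU.2⟩

end Atoms

/-! ## §3 The per-history density letter from ATOMIC letters, and the `hdomBG_j` binder from atomic letters -/

section Main

variable (F : T3Family) {γ : ℝ} (hγ : 0 ≤ γ) {K Ts j : ℕ} (hTs : Ts ≤ K) (hjK : j ≤ K)
  (Tg Sp : (i : ℕ) → Set (GaugeField (F.P i) 0 ↥(Matrix.specialUnitaryGroup (Fin 2) ℂ)))
  (Lg : (i : ℕ) → Plaq (F.P i) 0 → Set (GaugeField (F.P i) 0 ↥(Matrix.specialUnitaryGroup (Fin 2) ℂ)))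
  (hTgm : ∀ i, MeasurableSet (Tg i)) (hSpm : ∀ i, MeasurableSet (Sp i)) (hLgm : ∀ i p, MeasurableSet (Lg i p))
  (hcover : ∀ i U, U ∉ Tg i → ∃ p, U ∈ Lg i p)

include hγ hTs hTgm hSpm hLgm hcover

/-- ★★★ **THE PER-HISTORY DENSITY LETTER FROM ATOMIC LETTERS.**  Run `K`, bottom height `j`, cut steps `[j, Ts)`, plateau targets `Tg`, support windows `Sp`, per-plaquette large
events `Lg i p` covering `(Tg i)ᶜ` (all measurable); a history `S ⊆ [j, Ts)` and sizes `ε_i ≥ 0`.  IF for EVERY choice `π` of one plaquette `π_i ∈ Plaq^{(i+1)}` per large height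
`i ∈ S` the ATOMIC letter «`ρ^{E_{S,π}}_{K−j}(V) ≤ (Π_{i∈S} ε_i)·ρ^{E₁}_{K−j}(V)` for `dU_j`-a.e. `V ∈ D`» holds — print's small factor `ε_i ~ e^{−¼p²(g)}` PER LARGE PLAQUETTE,
(71) p.273, relative to the all-small term — THEN the history letter of ✓`…S1aHistoryLettersOfRestrictedDensities` holds with `ω_i := |Plaq^{(i+1)}|·ε_i`:
«`ρ^{E_S}_{K−j}(V) ≤ (Π_{i∈S} |Plaq^{(i+1)}|·ε_i)·ρ^{E₁}_{K−j}(V)` a.e. on `D`» (`D` measurable; union bound over the `Π_{i∈S}|Plaq^{(i+1)}|` atoms at measure level, back to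
densities by uniqueness).  Nothing of Bałaban's asserted; the atomic letters are HYPOTHESES. [cite: Balaban1985UV3, (7) p.257, (41) p.266 and (71) p.273] -/
theorem heightDensityLetter_of_atomicLetters (S : Finset ℕ) (hS : S ⊆ Finset.Ico j Ts) {ε : ℕ → ℝ} (hε : ∀ i, 0 ≤ ε i)
    {D : Set (GaugeField (F.P j) 0 ↥(Matrix.specialUnitaryGroup (Fin 2) ℂ))} (hDm : MeasurableSet D)
    (hatom : ∀ π : (i : ↥S) → Plaq (F.P ((i : ℕ) + 1)) 0,
      ∀ᵐ V ∂(fieldMeasure (F.P j) 0 ↥(Matrix.specialUnitaryGroup (Fin 2) ℂ)), V ∈ D →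
        heightDensity F γ hjK {U : GaugeField (F.P K) 0 ↥(Matrix.specialUnitaryGroup (Fin 2) ℂ) |
            (∀ i : ↥S, ∀ (h : (i : ℕ) + 1 ≤ K), descendTo F ℰp ((i : ℕ) + 1) K h U ∈ Lg ((i : ℕ) + 1) (π i)) ∧
            (∀ i ∈ Finset.Ico j Ts, i ∉ S → ∀ (h : i + 1 ≤ K), descendTo F ℰp (i + 1) K h U ∈ Sp (i + 1))} V ≤
          (∏ i ∈ S, ε i) * heightDensity F γ hjK {U : GaugeField (F.P K) 0 ↥(Matrix.specialUnitaryGroup (Fin 2) ℂ) |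
            ∀ i ∈ Finset.Ico j Ts, ∀ (h : i + 1 ≤ K), descendTo F ℰp (i + 1) K h U ∈ Tg (i + 1)} V) :
    ∀ᵐ V ∂(fieldMeasure (F.P j) 0 ↥(Matrix.specialUnitaryGroup (Fin 2) ℂ)), V ∈ D →
      heightDensity F γ hjK {U : GaugeField (F.P K) 0 ↥(Matrix.specialUnitaryGroup (Fin 2) ℂ) |
          (∀ i ∈ S, ∀ (h : i + 1 ≤ K), descendTo F ℰp (i + 1) K h U ∉ Tg (i + 1)) ∧
          (∀ i ∈ Finset.Ico j Ts, i ∉ S → ∀ (h : i + 1 ≤ K), descendTo F ℰp (i + 1) K h U ∈ Sp (i + 1))} V ≤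
        (∏ i ∈ S, ((Fintype.card (Plaq (F.P (i + 1)) 0) : ℝ) * ε i)) *
          heightDensity F γ hjK {U : GaugeField (F.P K) 0 ↥(Matrix.specialUnitaryGroup (Fin 2) ℂ) |
            ∀ i ∈ Finset.Ico j Ts, ∀ (h : i + 1 ≤ K), descendTo F ℰp (i + 1) K h U ∈ Tg (i + 1)} V := by
  have hSK : ∀ i ∈ S, i + 1 ≤ K := fun i hi => Nat.succ_le_of_lt (lt_of_lt_of_le (Finset.mem_Ico.mp (hS hi)).2 hTs)
  have hESm := measurableSet_histEvent F Tg Sp (K := K) (Ts := Ts) (j := j) hTgm hSpm S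
  have hE₁m := measurableSet_plateauEvent F Tg (K := K) (Ts := Ts) (j := j) hTgm
  have hc : 0 ≤ ∏ i ∈ S, ((Fintype.card (Plaq (F.P (i + 1)) 0) : ℝ) * ε i) :=
    Finset.prod_nonneg fun i _ => mul_nonneg (Nat.cast_nonneg _) (hε i)
  refine heightDensityLetter_of_restrictedMass F hγ hjK hESm hE₁m hc hDm fun A hA hAD => ?_
  -- per atom: the mass letter from the atomic density letter
  have hatomMass : ∀ π : (i : ↥S) → Plaq (F.P ((i : ℕ) + 1)) 0,
      gibbsK F ℰp γ K (descendTo F ℰp j K hjK ⁻¹' A ∩ {U : GaugeField (F.P K) 0 ↥(Matrix.specialUnitaryGroup (Fin 2) ℂ) |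
          (∀ i : ↥S, ∀ (h : (i : ℕ) + 1 ≤ K), descendTo F ℰp ((i : ℕ) + 1) K h U ∈ Lg ((i : ℕ) + 1) (π i)) ∧
          (∀ i ∈ Finset.Ico j Ts, i ∉ S → ∀ (h : i + 1 ≤ K), descendTo F ℰp (i + 1) K h U ∈ Sp (i + 1))}) ≤
        ENNReal.ofReal (∏ i ∈ S, ε i) * gibbsK F ℰp γ K (descendTo F ℰp j K hjK ⁻¹' A ∩
          {U : GaugeField (F.P K) 0 ↥(Matrix.specialUnitaryGroup (Fin 2) ℂ) | ∀ i ∈ Finset.Ico j Ts, ∀ (h : i + 1 ≤ K), descendTo F ℰp (i + 1) K h U ∈ Tg (i + 1)}) :=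
    fun π => restrictedMass_le_of_heightDensityLetter F hγ hjK (measurableSet_atomEvent F Sp Lg hSpm hLgm S π) hE₁m
      (Finset.prod_nonneg fun i _ => hε i) (hatom π) hA hAD
  refine (restrictedMass_le_card_mul_of_atoms (gibbsK F ℰp γ K) (histEvent_subset_iUnion_atomEvent F Tg Sp Lg hcover S hSK) hatomMass).trans
    (le_of_eq ?_)
  -- the count of atoms: `|Π_{i∈S} Plaq^{(i+1)}| · Π ε = Π (|Plaq^{(i+1)}|·ε)`
  congr 1
  rw [Fintype.card_pi, Finset.prod_mul_distrib, ENNReal.ofReal_mul (Finset.prod_nonneg fun i _ => Nat.cast_nonneg _), ← Nat.cast_prod,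
    ENNReal.ofReal_natCast, ← Finset.prod_coe_sort S fun i => Fintype.card (Plaq (F.P (i + 1)) 0)]

end Main

/-! ## §4 The composition: the `hdomBG_j` binder of the tower door of record from ATOMIC letters -/

section Compose

variable (F : T3Family) {γ : ℝ} (hγ : 0 ≤ γ)
  (ν : ℕ → (j : ℕ) → Measure (GaugeField (F.P j) 0 ↥(Matrix.specialUnitaryGroup (Fin 2) ℂ)))
  {K Ts : ℕ}
  (μ : (j : ℕ) → Measure (GaugeField (F.P j) 0 ↥(Matrix.specialUnitaryGroup (Fin 2) ℂ)))
  (χ : (i : ℕ) → GaugeField (F.P i) 0 ↥(Matrix.specialUnitaryGroup (Fin 2) ℂ) → ℝ)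
  (D Tg Sp : (i : ℕ) → Set (GaugeField (F.P i) 0 ↥(Matrix.specialUnitaryGroup (Fin 2) ℂ)))
  (Lg : (i : ℕ) → Plaq (F.P i) 0 → Set (GaugeField (F.P i) 0 ↥(Matrix.specialUnitaryGroup (Fin 2) ℂ)))
  -- S1aᴴ's run system and a cut tower with MEASURABLE real weights `χ` (the door's text)
  (hν1 : ∀ K, ν K K = T4GenFunBounds.gibbsMeasure (F.P K) ((F.scheme ℰp γ).β K))
  (hν2 : ∀ K j, j < K → ν K j = Measure.map (descend F ℰp j) (ν K (j + 1)))
  (hTs : Ts ≤ K) (hχm : ∀ i, Measurable (χ i)) (hχ1 : ∀ i U, χ i U ≤ 1)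
  (hanch : ∀ j, Ts ≤ j → μ j = ν K j)
  (hcut : ∀ j, j < Ts → μ j = Measure.map (descend F ℰp j) ((μ (j + 1)).withDensity fun U => ENNReal.ofReal (χ (j + 1) U)))
  -- the supplier's measurable plateau targets (`χ = 1`), support windows (`χ ≤ 0` outside) and per-plaquette large events covering the complement of the plateau
  {j : ℕ} (hjK : j ≤ K) (hTgm : ∀ i, MeasurableSet (Tg i)) (hSpm : ∀ i, MeasurableSet (Sp i)) (hLgm : ∀ i p, MeasurableSet (Lg i p))
  (hplat : ∀ (i : ℕ), j < i → i ≤ Ts → ∀ U ∈ Tg i, χ i U = 1)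
  (hsupp : ∀ (i : ℕ), j < i → i ≤ Ts → ∀ U, U ∉ Sp i → χ i U ≤ 0)
  (hcover : ∀ i U, U ∉ Tg i → ∃ p, U ∈ Lg i p)
  (hDm : MeasurableSet (D j))

include hγ hν1 hν2 hTs hχm hχ1 hanch hcut hjK hTgm hSpm hLgm hplat hsupp hcover hDm

/-- ★★★ **THE `hdomBG_j` BINDER OF THE TOWER DOOR OF RECORD (✓`…S1aAlphaPhiMTowerBG` l.86–90) FROM ATOMIC LETTERS — ONE SMALL FACTOR PER LARGE PLAQUETTE.**  In the door's scope, with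
the supplier's plateau targets `Tg`, support windows `Sp` and per-plaquette large events `Lg` (for the line's `sfCut θ_i`: `Tg_i = {∀p, dist1 ≤ θ_i∕2}`, `Sp_i = {∀p, dist1 < 24θ_i∕25}`,
`Lg i p = {θ_i∕2 < dist1 (U(∂p))}`): IF for every nonempty history `S ⊆ [j, Ts)` and every choice `π` of one plaquette per height of `S` the ATOMIC letter
«`ρ^{E_{S,π}}_{K−j}(V) ≤ (Π_{i∈S} ε_i)·ρ^{E₁}_{K−j}(V)` for `dU_j`-a.e. `V ∈ D_j`» holds, with `Σ_{i∈[j,Ts)} |Plaq^{(i+1)}|·ε_i ≤ Δ`, THEN `readAtLevel ρᵗ V ≤ e^{Δ}·readAtLevel ρᶜ V` at every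
(E)-good datum of the `θ`-window: the letter `hdomBG_j` VERBATIM (`θ := θBal F.L γ b₀ p₀ j`, `Δ := Δ j`).  ★p1's residual for the (m)_E cut heights in print's ATOMIC currency:
one factor `ε_i` per large plaquette against the site entropy `|Plaq^{(i+1)}| = 3|T^{(i+1)}|`.  Nothing of Bałaban's asserted; the atomic letters, `D_j`, `Tg`, `Sp`, `Lg`, `hgood` are
the supplier's. [cite: Balaban1985UV3, (7) p.257, (41) p.266, (47) p.267 and (71) p.273] -/
theorem hdomBG_of_atomicLetters (ε : ℕ → ℝ) (hε : ∀ i, 0 ≤ ε i)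
    (hatom : ∀ S ∈ (Finset.Ico j Ts).powerset, S.Nonempty → ∀ π : (i : ↥S) → Plaq (F.P ((i : ℕ) + 1)) 0,
      ∀ᵐ V ∂(fieldMeasure (F.P j) 0 ↥(Matrix.specialUnitaryGroup (Fin 2) ℂ)), V ∈ D j →
        heightDensity F γ hjK {U : GaugeField (F.P K) 0 ↥(Matrix.specialUnitaryGroup (Fin 2) ℂ) |
            (∀ i : ↥S, ∀ (h : (i : ℕ) + 1 ≤ K), descendTo F ℰp ((i : ℕ) + 1) K h U ∈ Lg ((i : ℕ) + 1) (π i)) ∧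
            (∀ i ∈ Finset.Ico j Ts, i ∉ S → ∀ (h : i + 1 ≤ K), descendTo F ℰp (i + 1) K h U ∈ Sp (i + 1))} V ≤
          (∏ i ∈ S, ε i) * heightDensity F γ hjK {U : GaugeField (F.P K) 0 ↥(Matrix.specialUnitaryGroup (Fin 2) ℂ) |
            ∀ i ∈ Finset.Ico j Ts, ∀ (h : i + 1 ≤ K), descendTo F ℰp (i + 1) K h U ∈ Tg (i + 1)} V)
    (hDo : IsOpen (D j)) {Δ : ℝ} (hΔ : ∑ i ∈ Finset.Ico j Ts, ((Fintype.card (Plaq (F.P (i + 1)) 0) : ℝ) * ε i) ≤ Δ)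
    (ρc ρt : GaugeField (F.P j) 0 ↥(Matrix.specialUnitaryGroup (Fin 2) ℂ) → ℝ) (hcc : Continuous ρc) (htc : Continuous ρt) (hc0 : ∀ V, 0 ≤ ρc V)
    (hμc : μ j = (fieldMeasure (F.P j) 0 ↥(Matrix.specialUnitaryGroup (Fin 2) ℂ)).withDensity fun V => ENNReal.ofReal (ρc V))
    (hνt : ν K j = (fieldMeasure (F.P j) 0 ↥(Matrix.specialUnitaryGroup (Fin 2) ℂ)).withDensity fun V => ENNReal.ofReal (ρt V))
    {θ R₀ : ℝ}
    (hgood : ∀ V : GaugeField (F.P K) (K - j) ↥(Matrix.specialUnitaryGroup (Fin 2) ℂ), PlaqSmall θ V →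
      (∃ U₀ : GaugeField (F.P K) 0 ↥(Matrix.specialUnitaryGroup (Fin 2) ℂ),
          IsBackground (fun i => BlockAveraging.blockAvg (P := F.P K) (j := i) ℰp) {U | PlaqSmall R₀ U} (K - j) V U₀ ∧
          PlaqSmall (θ * ((F.L : ℝ)⁻¹) ^ (2 * (K - j))) U₀) →
      fieldShift (heightShift_eq F hjK) V ∈ D j) :
    ∀ V : GaugeField (F.P K) (K - j) ↥(Matrix.specialUnitaryGroup (Fin 2) ℂ), PlaqSmall θ V →
      (∃ U₀ : GaugeField (F.P K) 0 ↥(Matrix.specialUnitaryGroup (Fin 2) ℂ),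
          IsBackground (fun i => BlockAveraging.blockAvg (P := F.P K) (j := i) ℰp) {U | PlaqSmall R₀ U} (K - j) V U₀ ∧
          PlaqSmall (θ * ((F.L : ℝ)⁻¹) ^ (2 * (K - j))) U₀) →
      readAtLevel F hjK ρt V ≤ Real.exp Δ * readAtLevel F hjK ρc V :=
  hdomBG_of_heightDensityLetters F hγ ν μ χ D Tg Sp hν1 hν2 hTs hχm hχ1 hanch hcut hjK hTgm hSpm hplat hsupp
    (fun i => ((Fintype.card (Plaq (F.P (i + 1)) 0) : ℝ) * ε i)) (fun i => mul_nonneg (Nat.cast_nonneg _) (hε i))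
    (fun S hS hSne => heightDensityLetter_of_atomicLetters F hγ hTs hjK Tg Sp Lg hTgm hSpm hLgm hcover S (Finset.mem_powerset.mp hS) hε hDm
      (hatom S hS hSne))
    hDo hΔ ρc ρt hcc htc hc0 hμc hνt hgood

end Compose

end Summit.QuantumFields.YangMills.Theorems.FluctuationComparisonRegPrIntLS1aHistoryLettersAtomic

end
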